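import Mathlib.RingTheory.Ideal.KrullsHeightTheorem
import Mathlib.RingTheory.Ideal.MinimalPrime.Basic
import Summits.ResolutionOfSingularities.ResolutionOfSingularities.Theorems.EquisingularLiftEquisingularLiftNatOversizedSpecialBranch
import Literature.AlgebraicGeometry.Resolution.CohenMacaulayCatenary
import Literature.AlgebraicGeometry.Resolution.DimensionFormula
import HarnessLib

/-!
# `EquisingularLiftNat` — helper: expected-dimensional components of the special fibre come from the generic
# fibre ((EDL♯), the componentwise sharpening of idea card 8 `expected-dimension-lifts`)

[OURS · L1 W4.5(b)] Support lemma for the crux `EquisingularLiftNat` (stmt-ResolutionOfSingularities-20038;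
`Summit.ResolutionOfSingularities.ResolutionOfSingularities.Theses.EquisingularLift.EquisingularLiftNat`). It types the
sharpening (EDL) → (EDL♯) proposed by res-L1-w45b-tri-2 (TRIAGE v5.2, 2026-08-27T06:31:45Z, on res-L1-w45b-idea-2's card 8,
Sketch `HOME/L/res-L1-w45b-idea-2/Sketch-L1-idea-2.lean` v5): «for the LIFT conclusion it suffices that `[X]` lie on AT LEAST
ONE irreducible component of `Hilb(ℙ³_k)` of dimension exactly `4d` … the contrapositive of (ISLAND)». NOT a statement of any
manuscript under review; AI-written kernel lemmas of the cell `res-hironaka` (weaker than expert review). Typed by res-type-018.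
No definition is declared. Companion files: `…OversizedSpecialBranch` (res-type-022, (ISLAND) = `SpecialBranch.OversizedSpecialBranch`,
imported and used by name) and `…BoeckleFlatOfExpectedDim` (res-type-018, the flatness form).

CONTENT (pure commutative algebra; `I = (f₁, …, f_o)`, `J = I + (ϖ)`, `P` a minimal prime of `J` — an irreducible component
of the special fibre `Spec S/J` of `Spec S/I → Spec O`).

* `exists_minimalPrime_le_not_mem_of_height_ge` — **no hypothesis on `ϖ`**: if `ht P ≥ o + 1` (the EXPECTED codimension of a
  component of `V(f₁,…,f_o,ϖ)`), then `P` contains a minimal prime `Q` of `I` with `ϖ ∉ Q`, i.e. the component `V(P)` lies in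
  the closure of the generic fibre `Spec S/I[1/ϖ]` [a minimal prime `Q ⊆ P` of `I` containing `ϖ` would equal `P` by the
  minimality of `P` over `J`, and then Krull's height theorem gives `ht P ≤ o`].
* `exists_minimalPrime_le_not_mem_of_codim_ge` — the same measured INSIDE the special fibre, for `ϖ` a non-zero-divisor:
  `ht(P/(ϖ)) ≥ o` in `S/(ϖ)` suffices (`SpecialBranch.height_map_quotient_add_one_le`: `ht(P/(ϖ)) + 1 ≤ ht P`).
* `height_eq_of_ringKrullDim_quotient_eq` — regular local bookkeeping: in a regular local ring of dimension `h + 1` a prime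
  `P` with `dim S/P = h − o` (`o ≤ h`) has height `o + 1` (regular ⇒ catenary domain,
  `Literature.AlgebraicGeometry.Resolution.isCatenaryRing_of_isRegularLocalRing` + the dimension formula
  `IsCatenaryRing.height_eq_height_add_height_map_quotientMk`).
* `exists_minimalPrime_le_not_mem_of_ringKrullDim_quotient_eq` — (EDL♯) in the dress of `boeckleFlatOfExpectedDim`:
  `S` regular local of dimension `h + 1` (read `W⟦t₁,…,t_h⟧`), `o ≤ h`, `P` a minimal prime of `(f) + (ϖ)` with
  `dim S/P = h − o` (read: `[X]` lies on a component of `Hilb(ℙ³_k)` of dimension exactly `4·deg X`) ⟹ `P ⊇ Q` for a minimal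
  prime `Q` of `(f)` with `ϖ ∉ Q` (read: that component lies in the closure of `Hilb(ℙ³_W)_ℚ`, so `[X]` lifts over a finite,
  possibly ramified, `O′ ⊇ W` — Liu Cor. 10.1.38 / EGA IV 14.5.3, not typed here).

References for the algebra: Krull's height theorem (Mathlib `Ideal.height_le_card_of_mem_minimalPrimes_span_finset`);
[Matsumura1987] Thm. 17.4 (ii), 17.8 (regular ⇒ catenary), §5 p. 31 (dimension formula). Kernel-only
(propext, Classical.choice, Quot.sound).
-/

-- single-problem summit: the doubled namespace component `ResolutionOfSingularities` is forced
set_option linter.dupNamespace false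

namespace Summit.ResolutionOfSingularities.ResolutionOfSingularities.Theorems.EquisingularLift.ExpectedDimension

open IsLocalRing Literature.AlgebraicGeometry.Resolution
open scoped nonZeroDivisors

universe u

section Noetherian

variable {S : Type u} [CommRing S] [IsNoetherianRing S]

/-- **(EDL♯), height form — expected-codimension components of `V(f₁,…,f_o,ϖ)` come from `V(f₁,…,f_o) ∖ V(ϖ)`.**
`S` Noetherian, `I = (f₁,…,f_o)`, `P` a minimal prime of `I + (ϖ)` with `ht P ≥ o + 1`. Then there is a minimal prime `Q`
of `I` with `Q ⊆ P` and `ϖ ∉ Q`. [A minimal prime `Q ⊆ P` of `I` exists; if `ϖ ∈ Q` then `I + (ϖ) ⊆ Q ⊆ P` forces `Q = P`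
by the minimality of `P`, so `P` is minimal over the `o`-generated ideal `I` and `ht P ≤ o` by Krull's height theorem —
against `ht P ≥ o + 1`.] No hypothesis on `ϖ`. [folklore; OURS for idea card 8 of res-L1-w45b-idea-2, sharpening (EDL♯) of
res-L1-w45b-tri-2] -/
theorem exists_minimalPrime_le_not_mem_of_height_ge {o : ℕ} (f : Fin o → S) (ϖ : S) {P : Ideal S}
    (hP : P ∈ (Ideal.span (Set.range f) ⊔ Ideal.span {ϖ}).minimalPrimes) (hht : (o : ℕ∞) + 1 ≤ P.height) :
    ∃ Q ∈ (Ideal.span (Set.range f)).minimalPrimes, Q ≤ P ∧ ϖ ∉ Q := by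
  haveI := hP.1.1
  have hIP : Ideal.span (Set.range f) ≤ P := le_sup_left.trans hP.1.2
  obtain ⟨Q, hQ, hQP⟩ := Ideal.exists_minimalPrimes_le hIP
  refine ⟨Q, hQ, hQP, fun hϖQ => ?_⟩
  haveI := hQ.1.1
  -- `Q ⊇ I + (ϖ)` and `Q ⊆ P`, so `Q = P` by the minimality of `P`
  have hJQ : Ideal.span (Set.range f) ⊔ Ideal.span {ϖ} ≤ Q :=
    sup_le hQ.1.2 ((Ideal.span_singleton_le_iff_mem _).mpr hϖQ)
  have hPQ : P ≤ Q := hP.2 ⟨hQ.1.1, hJQ⟩ hQP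
  have hQP' : Q = P := le_antisymm hQP hPQ
  rw [hQP'] at hQ
  -- Krull: `ht P ≤ o`
  have hle : P.height ≤ o := SpecialBranch.height_le_of_mem_minimalPrimes_span_range f hQ
  have h' : (o : ℕ∞) + 1 ≤ o := hht.trans hle
  exact (lt_irrefl (o : ℕ∞)) ((ENat.add_one_le_iff (ENat.coe_ne_top o)).mp h')

/-- **(EDL♯), special-fibre form.** `S` Noetherian, `ϖ` a non-zero-divisor, `I = (f₁,…,f_o)`, `P` a minimal prime of
`I + (ϖ)` whose image in `S/(ϖ)` has height `≥ o` — a component of the special fibre of the EXPECTED codimension `o` inside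
`Spec S/(ϖ)` (read: a component of `Hilb(ℙ³_k)` through `[X]` of dimension exactly `h⁰(N_X) − o`). Then `P` contains a minimal
prime `Q` of `I` with `ϖ ∉ Q`: the component lies in the closure of the generic fibre. [`ht(P/(ϖ)) + 1 ≤ ht P` for a
non-zero-divisor (`SpecialBranch.height_map_quotient_add_one_le`, res-type-022) and the height form.] The contrapositive of
(ISLAND) = `SpecialBranch.OversizedSpecialBranch`. [folklore; OURS, sharpening (EDL♯) of res-L1-w45b-tri-2] -/
theorem exists_minimalPrime_le_not_mem_of_codim_ge {ϖ : S} (hϖ : ϖ ∈ S⁰) {o : ℕ} (f : Fin o → S) {P : Ideal S}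
    (hP : P ∈ (Ideal.span (Set.range f) ⊔ Ideal.span {ϖ}).minimalPrimes)
    (hcodim : (o : ℕ∞) ≤ (P.map (Ideal.Quotient.mk (Ideal.span {ϖ}))).height) :
    ∃ Q ∈ (Ideal.span (Set.range f)).minimalPrimes, Q ≤ P ∧ ϖ ∉ Q := by
  haveI := hP.1.1
  have hϖP : ϖ ∈ P := hP.1.2 (Ideal.mem_sup_right (Ideal.mem_span_singleton_self ϖ))
  refine exists_minimalPrime_le_not_mem_of_height_ge f ϖ hP ?_
  calc (o : ℕ∞) + 1 ≤ (P.map (Ideal.Quotient.mk (Ideal.span {ϖ}))).height + 1 := add_le_add hcodim le_rfl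
    _ ≤ P.height := SpecialBranch.height_map_quotient_add_one_le hϖ P hϖP

/-- **(ISLAND) restated next to (EDL♯)** (res-type-022's `SpecialBranch.OversizedSpecialBranch`, universe-polymorphic dress):
a minimal prime `Q` of `I = (f₁,…,f_o)` containing the non-zero-divisor `ϖ` — a component of `Spec S/I` inside the special
fibre, hence absent from the generic fibre — has image of height `≤ o − 1` in `S/(ϖ)`: it is OVERSIZED inside the special
fibre. [Krull + `SpecialBranch.height_map_quotient_add_one_le`.] [folklore; OURS, idea card 8 step (b)] -/
theorem height_map_quotient_add_one_le_of_mem_minimalPrimes {ϖ : S} (hϖ : ϖ ∈ S⁰) {o : ℕ} (f : Fin o → S)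
    {Q : Ideal S} (hQ : Q ∈ (Ideal.span (Set.range f)).minimalPrimes) (hϖQ : ϖ ∈ Q) :
    (Q.map (Ideal.Quotient.mk (Ideal.span {ϖ}))).height + 1 ≤ (o : ℕ∞) := by
  haveI := hQ.1.1
  exact (SpecialBranch.height_map_quotient_add_one_le hϖ Q hϖQ).trans
    (SpecialBranch.height_le_of_mem_minimalPrimes_span_range f hQ)

end Noetherian

section RegularLocal

variable {S : Type u} [CommRing S] [IsRegularLocalRing S]

/-- **Regular local bookkeeping: `ht P + dim S/P = dim S`.** In a regular local ring of dimension `h + 1`, a prime `P` with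
`dim S/P = h − o` (`o ≤ h`) has height `o + 1` (regular ⇒ catenary domain, and the dimension formula
`ht 𝔪 = ht P + ht(𝔪/P)` with `ht(𝔪/P) = dim S/P`). [cite: Matsumura1987, Thm. 17.4 (ii), 17.8; §5 p. 31] -/
theorem height_eq_of_ringKrullDim_quotient_eq {h o : ℕ} (ho : o ≤ h)
    (hdim : ringKrullDim S = ((h + 1 : ℕ) : WithBot ℕ∞)) {P : Ideal S} [P.IsPrime]
    (hdimP : ringKrullDim (S ⧸ P) = ((h - o : ℕ) : WithBot ℕ∞)) : P.height = (o : ℕ∞) + 1 := by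
  -- write `h = o + m`, so that `h - o = m`
  obtain ⟨m, rfl⟩ := Nat.exists_eq_add_of_le ho
  rw [Nat.add_sub_cancel_left] at hdimP
  haveI := isDomain_of_isRegularLocalRing S
  have hPtop : P ≠ ⊤ := Ideal.IsPrime.ne_top ‹_›
  have hPm : P ≤ maximalIdeal S := le_maximalIdeal hPtop
  haveI : Nontrivial (S ⧸ P) := Ideal.Quotient.nontrivial_iff.mpr hPtop
  haveI : IsLocalRing (S ⧸ P) := isLocalRing_quotient hPtop
  -- `ht 𝔪 = o + m + 1`
  have hm : (maximalIdeal S).height = ((o + m + 1 : ℕ) : ℕ∞) := by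
    have e := (maximalIdeal_height_eq_ringKrullDim (R := S)).trans hdim
    rwa [← WithBot.coe_natCast, WithBot.coe_inj] at e
  -- `ht(𝔪/P) = dim S/P = m`
  have hmP : ((maximalIdeal S).map (Ideal.Quotient.mk P)).height = ((m : ℕ) : ℕ∞) := by
    rw [map_maximalIdeal_of_surjective _ Ideal.Quotient.mk_surjective]
    have e := (maximalIdeal_height_eq_ringKrullDim (R := S ⧸ P)).trans hdimP
    rwa [← WithBot.coe_natCast, WithBot.coe_inj] at e
  -- the dimension formula in the catenary domain `S`: `ht 𝔪 = ht P + ht(𝔪/P)`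
  have hform := (isCatenaryRing_of_isRegularLocalRing S).height_eq_height_add_height_map_quotientMk hPm
  rw [hm, hmP] at hform
  -- `P.height` is finite: solve `o + m + 1 = ht P + m`
  obtain ⟨n, hn⟩ := ENat.ne_top_iff_exists.mp (Ideal.height_ne_top hPtop)
  rw [← hn] at hform ⊢
  have e : o + m + 1 = n + m := by exact_mod_cast hform
  have e' : n = o + 1 := by omega
  rw [e']
  rfl

/-- **(EDL♯) in the dress of `boeckleFlatOfExpectedDim` — a special component of the EXPECTED dimension lies in the closure
of the generic fibre.** `S` regular local of dimension `h + 1` (read `W⟦t₁,…,t_h⟧`), `o ≤ h`, `I = (f₁,…,f_o)` (read: the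
`≤ h¹(N_X)` obstruction relations), `ϖ ∈ S` (read `p`), `P` a minimal prime of `I + (ϖ)` with `dim S/P = h − o` (read: `[X]`
lies on AT LEAST ONE irreducible component of `Hilb(ℙ³_k)` of dimension exactly `4·deg X`). Then `P ⊇ Q` for a minimal prime
`Q` of `I` with `ϖ ∉ Q` (read: that component lies in the closure of `Hilb(ℙ³_W)_ℚ`; the LIFT of `[X]` over a finite, possibly
ramified `O′ ⊇ W` then follows from the surjectivity of the reduction map on closed points, Liu Cor. 10.1.38 — not typed here).
«Only expected-dimensional components» is needed just for the flatness of the whole hull (`boeckleFlatOfExpectedDim`).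
[folklore; OURS — (EDL♯) of res-L1-w45b-tri-2 TRIAGE v5.2 on idea card 8 of res-L1-w45b-idea-2] -/
theorem exists_minimalPrime_le_not_mem_of_ringKrullDim_quotient_eq {h o : ℕ} (ho : o ≤ h)
    (hdim : ringKrullDim S = ((h + 1 : ℕ) : WithBot ℕ∞)) {f : Fin o → S} {ϖ : S} {P : Ideal S}
    (hP : P ∈ (Ideal.span (Set.range f) ⊔ Ideal.span {ϖ}).minimalPrimes)
    (hdimP : ringKrullDim (S ⧸ P) = ((h - o : ℕ) : WithBot ℕ∞)) :
    ∃ Q ∈ (Ideal.span (Set.range f)).minimalPrimes, Q ≤ P ∧ ϖ ∉ Q := by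
  haveI := hP.1.1
  exact exists_minimalPrime_le_not_mem_of_height_ge f ϖ hP (height_eq_of_ringKrullDim_quotient_eq ho hdim hdimP).ge

end RegularLocal

end Summit.ResolutionOfSingularities.ResolutionOfSingularities.Theorems.EquisingularLift.ExpectedDimension
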